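/-
Copyright (c) 2026 the pub-hodgecm-mathlib formalisation cell (harness21).  Prover seat hodgecm-mathlib-F0P3-p01 (g32): Track A «(D-RAM) FOUR-FRAME», unit U2H, census leaf
(ρ2b′-X) — T5b «TORIC LEVEL CENSUS, TYPE RamK»: the HYPERBOLIC-SIDE level counts as index differences and in index form (HEAD, part I).  2026-09-04.
-/
import Summits.HodgeConjecture.HodgeConjecture.Theorems.F0P3cDyRamToricCensusDefs    -- ★ p857239 (LH4-p12 (g4)): `IsOrd ∕ dualGen ∕ levelSet ∕ levelSetDep`
import Literature.NumberTheory.LocalFields.QuadraticOrderLevelClasses                 -- ★ (LH4-p08 (g4)): M∕E-unramified level-set reduction `#levelSet = [B:H] − [B′:H]` (hyperbolic translator)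
import Literature.NumberTheory.LocalFields.QuadraticOrderTorusIndices                 -- ★ (LH4-p08 (g4)): `[U_M : 𝒪_jˣ] = (q+1)q^{j−1}` (Flicker, M∕E unramified)
import Literature.NumberTheory.LocalFields.QuadraticOrderNormDepthIndexRamK           -- ★ p857459 (this seat): `[U_M : B_c] = idxRK q d c` (type RamK, two-field frame)
import Literature.NumberTheory.LocalFields.QuadraticOrderLevelClassesNonNorm          -- ★ (this seat, ED. 2): counts from depth-set equations + anisotropic RamK suppliers (bridge, coset∕empty)
import Summits.HodgeConjecture.HodgeConjecture.Theorems.F0P3cDyRamToricLevelCensusUnr -- ★ (LH4-p08 (g4)) T5a HEAD: `levelSet_eq_setOf` (the leaf set in spelled letters) BY NAME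
import HarnessLib

/-!
# H413 · (ρ2b′-X) toric census, TYPE RamK — the hyperbolic-side level sets `L_h(j,a)` as index differences, and their index form
(Flicker 1998 Prop. 7 p. 84; Serre, *Local Fields* Ch. V §1–§3; Jacobowitz 1962 §4)

Cell `pub/hodgecm-mathlib`, crux H413 = `stmt-HodgeConjecture-24833` (helper lane, count-neutral); THEOREMS ONLY (no definition, no instance, no notation, no named fact, no `sorry`).
T5b sheet `F0/P3/F0P3-p01/g32/T5bToricLevelCensusRamK.statements.v4` §2 (RK, hyperbolic side): in type RamK (`M∕E` unramified, `K♮∕F` unramified, `M∕K♮` ramified) the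
hyperbolic side has `ρh = −h` (WLOG), so the unit `1` is a translator (`(ρh∕h)·t(1) = −1`) and LH4-p08 (g4)'s ★ M∕E-unramified reduction `QuadraticOrderLevelClasses` applies
VERBATIM to the ★ DEFS-leaf set `levelSet ρ Θ α ϖE h j a` (the bridge of the leaf's level clause `|y| = |ϖE|^a` to `exp(−a)` is ★ T5a's `levelSet_eq_setOf`, imported):
* §2 `ncard_levelSet_eq_relIndex_sub_of_ramK_hyper` (`a ≥ 1`: `#L = [B_{j−a} : 𝒪_jˣ] − [B_{j−a+1} : 𝒪_jˣ]`), `…_zero_eq_relIndex_…` (`a = 0`), `…_eq_zero_of_odd_…` (parity);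
* §3 INDEX FORM (`[U_M : 𝒪_jˣ] = (q+1)q^{j−1}`, ★ Flicker in `Mˣ`): `#L·[U:B]·[U:B′] = (q+1)q^{j−1}·([U:B′] − [U:B])`, `#L(j,0)·[U:B_j] = (q+1)q^{j−1}` — where every `[U : B_c]` is
  the ★ kernel fact `relIndex_normDepth_eq_of_ramK` = `idxRK q d c` (p857459); the explicit `(q,d)`-table of the sheet is the arithmetic of these two lines (ED. 2).
HONEST LABEL: HC_CM is proved only modulo the 7 printed citations (2 remaining named inputs: hLiu418 = stmt-HodgeConjecture-24832, h413 = stmt-HodgeConjecture-24833) until rung 0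
closes; (ρ2b′-X) stays an OPEN prover target; this file moves no registry (helper lane).

ED. 2 (append-only): §4 the ANISOTROPIC side (`h = h₊·n₀`) — counts from the depth-set equations of ★ `QuadraticOrderLevelClassesNonNorm` with the member ∕ no-member
data as binders; §5 its index forms.

## References
* [Flicker1998UnitaryFL] Y. Z. Flicker, *Elementary proof of the fundamental lemma for a unitary group*, Canad. J. Math. 50 (1998): Prop. 7 and REMARK p. 84.
* [Serre1979] J.-P. Serre, *Local Fields*, GTM 67 (1979): Ch. V §1, §3.
* [Jacobowitz1962] R. Jacobowitz, *Hermitian forms over local fields*, Amer. J. Math. 84 (1962): §4.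
-/

set_option autoImplicit false

noncomputable section

namespace Summit.HodgeConjecture.HodgeConjecture.Cruxes.H413.F0P3cDyRamToricLevelCensusRamK

open WithZero
open scoped Pointwise Valued
open Literature.NumberTheory.LocalFields.QuadraticOrder
open Summit.HodgeConjecture.HodgeConjecture.Cruxes.H413.F0P3cDyRamToricCensusDefs

variable {K : Type} [Field K] [Valued K ℤᵐ⁰] {ρ Θ : K →+* K} {α ϖE h : K}

/-! ## §1 The hyperbolic translator (the leaf set in spelled letters is ★ `F0P3cDyRamToricLevelCensusUnr.levelSet_eq_setOf`, LH4-p08 (g4)) -/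

omit [Valued K ℤᵐ⁰] in
/-- The unit `1` is a translator on the hyperbolic side: `ρh = −h`, `h ≠ 0` ⇒ `(ρh∕h)·(ρ(1·Θ1)∕(1·Θ1)) = −1`. [cite: Jacobowitz1962, §4] -/
theorem translator_one (hh : h ≠ 0) (hρh : ρ h = -h) :
    ρ h / h * (ρ (((1 : Kˣ) : K) * Θ ((1 : Kˣ) : K)) / (((1 : Kˣ) : K) * Θ ((1 : Kˣ) : K))) = -1 := by
  rw [Units.val_one, map_one, one_mul, map_one, div_one, mul_one, hρh, neg_div, div_self hh]

/-! ## §2 The hyperbolic counts as index differences (★ `QuadraticOrderLevelClasses` with translator `1`) -/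

/-- **RamK, hyperbolic side, `a ≥ 1`**: `#L_h(j,a) = [B_{j−a} : 𝒪_jˣ] − [B_{j−a+1} : 𝒪_jˣ]` (parity `v_h + 2k₀ + j = a`; `H = 𝒪_jˣ ≤ B′`; finiteness of the class image).
[cite: Flicker1998UnitaryFL, p. 84] [cite: Serre1979, Ch. V §3] -/
theorem ncard_levelSet_eq_relIndex_sub_of_ramK_hyper (hρρ : ∀ x, ρ (ρ x) = x) (hvρ : ∀ x, Valued.v (ρ x) = Valued.v x) (hΘρ : ∀ x, Θ (ρ x) = ρ (Θ x))
    (hvΘ : ∀ x, Valued.v (Θ x) = Valued.v x) (hα : Valued.v (α - ρ α) = 1) (hϖ : Valued.v ϖE = exp (-1 : ℤ)) (hρϖ : ρ ϖE = ϖE)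
    (hh : h ≠ 0) (hρh : ρ h = -h) {vh : ℤ} (hvh : Valued.v h = exp (-vh)) (j : ℕ) {a : ℕ} (ha : 1 ≤ a) {k₀ : ℤ} (hk₀ : vh + 2 * k₀ + j = a)
    (H B B' : Subgroup Kˣ) (hH : ∀ u : Kˣ, u ∈ H ↔ Valued.v (u : K) = 1 ∧ Valued.v ((u : K) - ρ u) ≤ Valued.v (ϖE ^ j * (α - ρ α)))
    (hB : ∀ ω : Kˣ, ω ∈ B ↔ Valued.v (ω : K) = 1 ∧ Valued.v ((ω : K) * Θ ω - ρ ((ω : K) * Θ ω)) ≤ exp (-((j : ℤ) - a)))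
    (hB' : ∀ ω : Kˣ, ω ∈ B' ↔ Valued.v (ω : K) = 1 ∧ Valued.v ((ω : K) * Θ ω - ρ ((ω : K) * Θ ω)) ≤ exp (-((j : ℤ) - a + 1)))
    (hHB' : H ≤ B') (hfin : ((QuotientGroup.mk : Kˣ → Kˣ ⧸ H) '' ((1 : Kˣ) • (B : Set Kˣ))).Finite) :
    (levelSet ρ Θ α ϖE h j a).ncard = H.relIndex B - H.relIndex B' := by
  rw [F0P3cDyRamToricLevelCensusUnr.levelSet_eq_setOf hϖ]
  exact ncard_levelSet_eq_relIndex_sub hρρ hvρ hΘρ hvΘ hα hϖ hρϖ hh hvh j ha hk₀ (ω₀ := 1) (by rw [Units.val_one, map_one]) (translator_one hh hρh)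
    H B B' hH hB hB' hHB' hfin

/-- **RamK, hyperbolic side, `a = 0`**: `#L_h(j,0) = [B_j : 𝒪_jˣ]` (parity `v_h + 2k₀ + j = 0`). [cite: Flicker1998UnitaryFL, p. 84] [cite: Serre1979, Ch. V §3] -/
theorem ncard_levelSet_zero_eq_relIndex_of_ramK_hyper (hρρ : ∀ x, ρ (ρ x) = x) (hvρ : ∀ x, Valued.v (ρ x) = Valued.v x) (hΘρ : ∀ x, Θ (ρ x) = ρ (Θ x))
    (hvΘ : ∀ x, Valued.v (Θ x) = Valued.v x) (hα : Valued.v (α - ρ α) = 1) (hϖ : Valued.v ϖE = exp (-1 : ℤ)) (hρϖ : ρ ϖE = ϖE)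
    (hh : h ≠ 0) (hρh : ρ h = -h) {vh : ℤ} (hvh : Valued.v h = exp (-vh)) (j : ℕ) {k₀ : ℤ} (hk₀ : vh + 2 * k₀ + j = 0)
    (H B : Subgroup Kˣ) (hH : ∀ u : Kˣ, u ∈ H ↔ Valued.v (u : K) = 1 ∧ Valued.v ((u : K) - ρ u) ≤ Valued.v (ϖE ^ j * (α - ρ α)))
    (hB : ∀ ω : Kˣ, ω ∈ B ↔ Valued.v (ω : K) = 1 ∧ Valued.v ((ω : K) * Θ ω - ρ ((ω : K) * Θ ω)) ≤ exp (-(j : ℤ))) :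
    (levelSet ρ Θ α ϖE h j 0).ncard = H.relIndex B := by
  rw [F0P3cDyRamToricLevelCensusUnr.levelSet_eq_setOf hϖ]
  exact ncard_levelSet_zero_eq_relIndex hρρ hvρ hΘρ hvΘ hα hϖ hρϖ hh hvh j hk₀ (ω₀ := 1) (by rw [Units.val_one, map_one]) (translator_one hh hρh) H B hH hB

/-- **RamK, ODD PARITY ⇒ `#L_h(j,a) = 0`** (no translator needed; both sides). [cite: Flicker1998UnitaryFL, p. 84] -/
theorem ncard_levelSet_eq_zero_of_odd_ramK (hvρ : ∀ x, Valued.v (ρ x) = Valued.v x) (hvΘ : ∀ x, Valued.v (Θ x) = Valued.v x)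
    (hα : Valued.v (α - ρ α) = 1) (hϖ : Valued.v ϖE = exp (-1 : ℤ)) {vh : ℤ} (hvh : Valued.v h = exp (-vh)) (j a : ℕ) (hodd : ∀ k : ℤ, vh + 2 * k + j ≠ a)
    (H : Subgroup Kˣ) (hH : ∀ u : Kˣ, u ∈ H ↔ Valued.v (u : K) = 1 ∧ Valued.v ((u : K) - ρ u) ≤ Valued.v (ϖE ^ j * (α - ρ α))) :
    (levelSet ρ Θ α ϖE h j a).ncard = 0 := by
  rw [F0P3cDyRamToricLevelCensusUnr.levelSet_eq_setOf hϖ]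
  exact ncard_levelSet_eq_zero_of_odd hvρ hvΘ hα hϖ hvh j a hodd H hH

/-! ## §3 The index form (`[U_M : 𝒪_jˣ] = (q+1)q^{j−1}`, `j ≥ 1`) -/

/-- **RamK INDEX FORM, `a ≥ 1`, `j ≥ 1`**: `#L_h(j,a) · [U:B] · [U:B′] = (q+1)q^{j−1} · ([U:B′] − [U:B])` for `H ≤ B′ ≤ B ≤ U = {|u|=1}` — with `[U : B_c] = idxRK q d c` (★ p857459)
this is the sheet's `n₊(j,a) = |G_j|·(1∕I(j−a) − 1∕I(j−a+1))`. [cite: Flicker1998UnitaryFL, Prop. 7 p. 84] [cite: Serre1979, Ch. V §3] -/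
theorem ncard_levelSet_mul_eq_of_ramK_hyper [IsDiscreteValuationRing 𝒪[K]] [Finite 𝓀[K]]
    (hρρ : ∀ x, ρ (ρ x) = x) (hvρ : ∀ x, Valued.v (ρ x) = Valued.v x) (hΘρ : ∀ x, Θ (ρ x) = ρ (Θ x)) (hvΘ : ∀ x, Valued.v (Θ x) = Valued.v x)
    (hα1 : Valued.v α ≤ 1) (hα : Valued.v (α - ρ α) = 1) (hϖ : Valued.v ϖE = exp (-1 : ℤ)) (hρϖ : ρ ϖE = ϖE) {q : ℕ} (hq : Nat.card 𝓀[K] = q ^ 2)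
    (hh : h ≠ 0) (hρh : ρ h = -h) {vh : ℤ} (hvh : Valued.v h = exp (-vh)) {j : ℕ} (hj : 1 ≤ j) {a : ℕ} (ha : 1 ≤ a) {k₀ : ℤ} (hk₀ : vh + 2 * k₀ + j = a)
    (U H B B' : Subgroup Kˣ) (hU : ∀ u : Kˣ, u ∈ U ↔ Valued.v (u : K) = 1)
    (hH : ∀ u : Kˣ, u ∈ H ↔ Valued.v (u : K) = 1 ∧ Valued.v ((u : K) - ρ u) ≤ Valued.v (ϖE ^ j * (α - ρ α)))
    (hB : ∀ ω : Kˣ, ω ∈ B ↔ Valued.v (ω : K) = 1 ∧ Valued.v ((ω : K) * Θ ω - ρ ((ω : K) * Θ ω)) ≤ exp (-((j : ℤ) - a)))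
    (hB' : ∀ ω : Kˣ, ω ∈ B' ↔ Valued.v (ω : K) = 1 ∧ Valued.v ((ω : K) * Θ ω - ρ ((ω : K) * Θ ω)) ≤ exp (-((j : ℤ) - a + 1)))
    (hHB' : H ≤ B') (hB'B : B' ≤ B) (hBU : B ≤ U) (hfin : ((QuotientGroup.mk : Kˣ → Kˣ ⧸ H) '' ((1 : Kˣ) • (B : Set Kˣ))).Finite) :
    (levelSet ρ Θ α ϖE h j a).ncard * B.relIndex U * B'.relIndex U = (q + 1) * q ^ (j - 1) * (B'.relIndex U - B.relIndex U) := by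
  have hcount := ncard_levelSet_eq_relIndex_sub_of_ramK_hyper hρρ hvρ hΘρ hvΘ hα hϖ hρϖ hh hρh hvh j ha hk₀ H B B' hH hB hB' hHB' hfin
  have hHU : H.relIndex U = (q + 1) * q ^ (j - 1) :=
    relIndex_orderUnits_eq_of_unramified hρρ hvρ hα1 hα hϖ hq hj U H hU (fun u => by rw [hH, map_mul, map_pow, hα, mul_one])
  have htB : H.relIndex B * B.relIndex U = (q + 1) * q ^ (j - 1) := by rw [Subgroup.relIndex_mul_relIndex H B U (hHB'.trans hB'B) hBU, hHU]
  have htB' : H.relIndex B' * B'.relIndex U = (q + 1) * q ^ (j - 1) := by rw [Subgroup.relIndex_mul_relIndex H B' U hHB' (hB'B.trans hBU), hHU]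
  rw [hcount, Nat.sub_mul, Nat.sub_mul, Nat.mul_sub]
  congr 1
  · rw [htB]
  · rw [mul_right_comm, htB']

/-- **RamK INDEX FORM, `a = 0`, `j ≥ 1`**: `#L_h(j,0) · [U:B_j] = (q+1)q^{j−1}`. [cite: Flicker1998UnitaryFL, Prop. 7 p. 84] -/
theorem ncard_levelSet_zero_mul_eq_of_ramK_hyper [IsDiscreteValuationRing 𝒪[K]] [Finite 𝓀[K]]
    (hρρ : ∀ x, ρ (ρ x) = x) (hvρ : ∀ x, Valued.v (ρ x) = Valued.v x) (hΘρ : ∀ x, Θ (ρ x) = ρ (Θ x)) (hvΘ : ∀ x, Valued.v (Θ x) = Valued.v x)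
    (hα1 : Valued.v α ≤ 1) (hα : Valued.v (α - ρ α) = 1) (hϖ : Valued.v ϖE = exp (-1 : ℤ)) (hρϖ : ρ ϖE = ϖE) {q : ℕ} (hq : Nat.card 𝓀[K] = q ^ 2)
    (hh : h ≠ 0) (hρh : ρ h = -h) {vh : ℤ} (hvh : Valued.v h = exp (-vh)) {j : ℕ} (hj : 1 ≤ j) {k₀ : ℤ} (hk₀ : vh + 2 * k₀ + j = 0)
    (U H B : Subgroup Kˣ) (hU : ∀ u : Kˣ, u ∈ U ↔ Valued.v (u : K) = 1)
    (hH : ∀ u : Kˣ, u ∈ H ↔ Valued.v (u : K) = 1 ∧ Valued.v ((u : K) - ρ u) ≤ Valued.v (ϖE ^ j * (α - ρ α)))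
    (hB : ∀ ω : Kˣ, ω ∈ B ↔ Valued.v (ω : K) = 1 ∧ Valued.v ((ω : K) * Θ ω - ρ ((ω : K) * Θ ω)) ≤ exp (-(j : ℤ)))
    (hHB : H ≤ B) (hBU : B ≤ U) :
    (levelSet ρ Θ α ϖE h j 0).ncard * B.relIndex U = (q + 1) * q ^ (j - 1) := by
  rw [ncard_levelSet_zero_eq_relIndex_of_ramK_hyper hρρ hvρ hΘρ hvΘ hα hϖ hρϖ hh hρh hvh j hk₀ H B hH hB, Subgroup.relIndex_mul_relIndex H B U hHB hBU]
  exact relIndex_orderUnits_eq_of_unramified hρρ hvρ hα1 hα hϖ hq hj U H hU (fun u => by rw [hH, map_mul, map_pow, hα, mul_one])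


/-! ## §4 (ED. 2) The ANISOTROPIC side: `h = h₊·n₀`, `ρh₊ = −h₊`, `n₀` a unit — counts from the depth-set equations (★ `QuadraticOrderLevelClassesNonNorm`)

On the − side of type RamK the side scalar is `h₋ = h₊·n₀` with `n₀` a `Θ`-fixed NON-NORM unit; `|1 + η·t(ω)| = |n₀N(ω) − ρ(n₀N(ω))|` (bridge), the depth set at radius `R` is
`ω₁·B_R` for any unit `ω₁` of twisted depth `≤ R` and `∅` if there is none (★ `QuadraticOrderNormDepthIndexTwo` §3: a member exists iff `c + 2 ≤ 2d`, `R = exp(−c)`).  The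
member ∕ no-member data are BINDERS here (the payer discharges them from ★ p857360 §3 in its frame). -/

/-- **RamK, anisotropic side, `a ≥ 1`, both depth sets inhabited** (a unit `ω₂` of twisted depth `≤ exp(−(j−a+1))`): `#L_{h₊n₀}(j,a) = [B : 𝒪_jˣ] − [B′ : 𝒪_jˣ]`.
[cite: Flicker1998UnitaryFL, p. 84] [cite: Jacobowitz1962, §4] -/
theorem ncard_levelSet_eq_relIndex_sub_of_ramK_aniso (hρρ : ∀ x, ρ (ρ x) = x) (hvρ : ∀ x, Valued.v (ρ x) = Valued.v x) (hΘρ : ∀ x, Θ (ρ x) = ρ (Θ x))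
    (hvΘ : ∀ x, Valued.v (Θ x) = Valued.v x) (hα : Valued.v (α - ρ α) = 1) (hϖ : Valued.v ϖE = exp (-1 : ℤ)) (hρϖ : ρ ϖE = ϖE)
    {hp n₀ : K} (hhp : hp ≠ 0) (hρh : ρ hp = -hp) (hn₀ : Valued.v n₀ = 1) {vh : ℤ} (hvh : Valued.v (hp * n₀) = exp (-vh)) (j : ℕ) {a : ℕ} (ha : 1 ≤ a) {k₀ : ℤ} (hk₀ : vh + 2 * k₀ + j = a)
    (H B B' : Subgroup Kˣ) (hH : ∀ u : Kˣ, u ∈ H ↔ Valued.v (u : K) = 1 ∧ Valued.v ((u : K) - ρ u) ≤ Valued.v (ϖE ^ j * (α - ρ α)))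
    (hB : ∀ ω : Kˣ, ω ∈ B ↔ Valued.v (ω : K) = 1 ∧ Valued.v ((ω : K) * Θ ω - ρ ((ω : K) * Θ ω)) ≤ exp (-((j : ℤ) - a)))
    (hB' : ∀ ω : Kˣ, ω ∈ B' ↔ Valued.v (ω : K) = 1 ∧ Valued.v ((ω : K) * Θ ω - ρ ((ω : K) * Θ ω)) ≤ exp (-((j : ℤ) - a + 1)))
    (hHB' : H ≤ B') {ω₂ : Kˣ} (hω₂ : Valued.v (ω₂ : K) = 1) (h₂ : Valued.v (n₀ * ((ω₂ : K) * Θ ω₂) - ρ (n₀ * ((ω₂ : K) * Θ ω₂))) ≤ exp (-((j : ℤ) - a + 1)))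
    (hfin : ((QuotientGroup.mk : Kˣ → Kˣ ⧸ H) '' (ω₂ • (B : Set Kˣ))).Finite) :
    (levelSet ρ Θ α ϖE (hp * n₀) j a).ncard = H.relIndex B - H.relIndex B' := by
  have hh : hp * n₀ ≠ 0 := mul_ne_zero hhp (fun h0 => by rw [h0, map_zero] at hn₀; exact zero_ne_one hn₀)
  have hB'B : B' ≤ B := fun ω hω => (hB ω).2 ⟨((hB' ω).1 hω).1, ((hB' ω).1 hω).2.trans (by rw [exp_le_exp]; omega)⟩
  rw [F0P3cDyRamToricLevelCensusUnr.levelSet_eq_setOf hϖ]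
  exact ncard_levelSet_eq_relIndex_sub_of_eq_smul hρρ hvρ hΘρ hvΘ hα hϖ hρϖ hh hvh j ha hk₀ H hH hB'B hHB'
    (setOf_twistDepth_le_eq_smul_of_antiFixed_mul hvρ hvΘ hρh hhp hn₀ _ hω₂ (h₂.trans (by rw [exp_le_exp]; omega)) hB)
    (setOf_twistDepth_le_eq_smul_of_antiFixed_mul hvρ hvΘ hρh hhp hn₀ _ hω₂ h₂ hB') hfin

/-- **RamK, anisotropic side, `a ≥ 1`, outer depth set inhabited, inner empty** (`ω₁` of twisted depth `≤ exp(−(j−a))`, no unit of twisted depth `≤ exp(−(j−a+1))`):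
`#L_{h₊n₀}(j,a) = [B : 𝒪_jˣ]`. [cite: Flicker1998UnitaryFL, p. 84] [cite: Jacobowitz1962, §4] -/
theorem ncard_levelSet_eq_relIndex_of_ramK_aniso (hρρ : ∀ x, ρ (ρ x) = x) (hvρ : ∀ x, Valued.v (ρ x) = Valued.v x) (hΘρ : ∀ x, Θ (ρ x) = ρ (Θ x))
    (hvΘ : ∀ x, Valued.v (Θ x) = Valued.v x) (hα : Valued.v (α - ρ α) = 1) (hϖ : Valued.v ϖE = exp (-1 : ℤ)) (hρϖ : ρ ϖE = ϖE)
    {hp n₀ : K} (hhp : hp ≠ 0) (hρh : ρ hp = -hp) (hn₀ : Valued.v n₀ = 1) {vh : ℤ} (hvh : Valued.v (hp * n₀) = exp (-vh)) (j : ℕ) {a : ℕ} (ha : 1 ≤ a) {k₀ : ℤ} (hk₀ : vh + 2 * k₀ + j = a)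
    (H B : Subgroup Kˣ) (hH : ∀ u : Kˣ, u ∈ H ↔ Valued.v (u : K) = 1 ∧ Valued.v ((u : K) - ρ u) ≤ Valued.v (ϖE ^ j * (α - ρ α)))
    (hB : ∀ ω : Kˣ, ω ∈ B ↔ Valued.v (ω : K) = 1 ∧ Valued.v ((ω : K) * Θ ω - ρ ((ω : K) * Θ ω)) ≤ exp (-((j : ℤ) - a)))
    {ω₁ : Kˣ} (hω₁ : Valued.v (ω₁ : K) = 1) (h₁ : Valued.v (n₀ * ((ω₁ : K) * Θ ω₁) - ρ (n₀ * ((ω₁ : K) * Θ ω₁))) ≤ exp (-((j : ℤ) - a)))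
    (hnone : ∀ ω : K, Valued.v ω = 1 → ¬ Valued.v (n₀ * (ω * Θ ω) - ρ (n₀ * (ω * Θ ω))) ≤ exp (-((j : ℤ) - a + 1))) :
    (levelSet ρ Θ α ϖE (hp * n₀) j a).ncard = H.relIndex B := by
  have hh : hp * n₀ ≠ 0 := mul_ne_zero hhp (fun h0 => by rw [h0, map_zero] at hn₀; exact zero_ne_one hn₀)
  rw [F0P3cDyRamToricLevelCensusUnr.levelSet_eq_setOf hϖ]
  exact ncard_levelSet_eq_relIndex_of_eq_smul_of_eq_empty hρρ hvρ hΘρ hvΘ hα hϖ hρϖ hh hvh j ha hk₀ H hH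
    (setOf_twistDepth_le_eq_smul_of_antiFixed_mul hvρ hvΘ hρh hhp hn₀ _ hω₁ h₁ hB)
    (setOf_twistDepth_le_eq_empty_of_antiFixed_mul hvΘ hρh hhp hn₀ _ hnone)

/-- **RamK, anisotropic side, `a ≥ 1`, outer depth set empty** (no unit of twisted depth `≤ exp(−(j−a))`): `#L_{h₊n₀}(j,a) = 0`. [cite: Flicker1998UnitaryFL, p. 84] -/
theorem ncard_levelSet_eq_zero_of_ramK_aniso (hρρ : ∀ x, ρ (ρ x) = x) (hvρ : ∀ x, Valued.v (ρ x) = Valued.v x) (hΘρ : ∀ x, Θ (ρ x) = ρ (Θ x))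
    (hvΘ : ∀ x, Valued.v (Θ x) = Valued.v x) (hα : Valued.v (α - ρ α) = 1) (hϖ : Valued.v ϖE = exp (-1 : ℤ)) (hρϖ : ρ ϖE = ϖE)
    {hp n₀ : K} (hhp : hp ≠ 0) (hρh : ρ hp = -hp) (hn₀ : Valued.v n₀ = 1) {vh : ℤ} (hvh : Valued.v (hp * n₀) = exp (-vh)) (j : ℕ) {a : ℕ} (ha : 1 ≤ a) {k₀ : ℤ} (hk₀ : vh + 2 * k₀ + j = a)
    (H : Subgroup Kˣ) (hH : ∀ u : Kˣ, u ∈ H ↔ Valued.v (u : K) = 1 ∧ Valued.v ((u : K) - ρ u) ≤ Valued.v (ϖE ^ j * (α - ρ α)))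
    (hnone : ∀ ω : K, Valued.v ω = 1 → ¬ Valued.v (n₀ * (ω * Θ ω) - ρ (n₀ * (ω * Θ ω))) ≤ exp (-((j : ℤ) - a))) :
    (levelSet ρ Θ α ϖE (hp * n₀) j a).ncard = 0 := by
  have hh : hp * n₀ ≠ 0 := mul_ne_zero hhp (fun h0 => by rw [h0, map_zero] at hn₀; exact zero_ne_one hn₀)
  rw [F0P3cDyRamToricLevelCensusUnr.levelSet_eq_setOf hϖ]
  exact ncard_levelSet_eq_zero_of_eq_empty hρρ hvρ hΘρ hvΘ hα hϖ hρϖ hh hvh j ha hk₀ H hH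
    (setOf_twistDepth_le_eq_empty_of_antiFixed_mul hvΘ hρh hhp hn₀ _ hnone)

/-- **RamK, anisotropic side, `a = 0`, depth set inhabited** (`ω₁` of twisted depth `≤ exp(−j)`): `#L_{h₊n₀}(j,0) = [B_j : 𝒪_jˣ]`. [cite: Flicker1998UnitaryFL, p. 84] -/
theorem ncard_levelSet_zero_eq_relIndex_of_ramK_aniso (hρρ : ∀ x, ρ (ρ x) = x) (hvρ : ∀ x, Valued.v (ρ x) = Valued.v x) (hΘρ : ∀ x, Θ (ρ x) = ρ (Θ x))
    (hvΘ : ∀ x, Valued.v (Θ x) = Valued.v x) (hα : Valued.v (α - ρ α) = 1) (hϖ : Valued.v ϖE = exp (-1 : ℤ)) (hρϖ : ρ ϖE = ϖE)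
    {hp n₀ : K} (hhp : hp ≠ 0) (hρh : ρ hp = -hp) (hn₀ : Valued.v n₀ = 1) {vh : ℤ} (hvh : Valued.v (hp * n₀) = exp (-vh)) (j : ℕ) {k₀ : ℤ} (hk₀ : vh + 2 * k₀ + j = 0)
    (H B : Subgroup Kˣ) (hH : ∀ u : Kˣ, u ∈ H ↔ Valued.v (u : K) = 1 ∧ Valued.v ((u : K) - ρ u) ≤ Valued.v (ϖE ^ j * (α - ρ α)))
    (hB : ∀ ω : Kˣ, ω ∈ B ↔ Valued.v (ω : K) = 1 ∧ Valued.v ((ω : K) * Θ ω - ρ ((ω : K) * Θ ω)) ≤ exp (-(j : ℤ)))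
    {ω₁ : Kˣ} (hω₁ : Valued.v (ω₁ : K) = 1) (h₁ : Valued.v (n₀ * ((ω₁ : K) * Θ ω₁) - ρ (n₀ * ((ω₁ : K) * Θ ω₁))) ≤ exp (-(j : ℤ))) :
    (levelSet ρ Θ α ϖE (hp * n₀) j 0).ncard = H.relIndex B := by
  have hh : hp * n₀ ≠ 0 := mul_ne_zero hhp (fun h0 => by rw [h0, map_zero] at hn₀; exact zero_ne_one hn₀)
  rw [F0P3cDyRamToricLevelCensusUnr.levelSet_eq_setOf hϖ]
  exact ncard_levelSet_zero_eq_relIndex_of_eq_smul hρρ hvρ hΘρ hvΘ hα hϖ hρϖ hh hvh j hk₀ H hH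
    (setOf_twistDepth_le_eq_smul_of_antiFixed_mul hvρ hvΘ hρh hhp hn₀ _ hω₁ h₁ hB)

/-- **RamK, anisotropic side, `a = 0`, depth set empty** (no unit of twisted depth `≤ exp(−j)`): `#L_{h₊n₀}(j,0) = 0`. [cite: Flicker1998UnitaryFL, p. 84] -/
theorem ncard_levelSet_zero_eq_zero_of_ramK_aniso (hρρ : ∀ x, ρ (ρ x) = x) (hvρ : ∀ x, Valued.v (ρ x) = Valued.v x) (hΘρ : ∀ x, Θ (ρ x) = ρ (Θ x))
    (hvΘ : ∀ x, Valued.v (Θ x) = Valued.v x) (hα : Valued.v (α - ρ α) = 1) (hϖ : Valued.v ϖE = exp (-1 : ℤ)) (hρϖ : ρ ϖE = ϖE)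
    {hp n₀ : K} (hhp : hp ≠ 0) (hρh : ρ hp = -hp) (hn₀ : Valued.v n₀ = 1) {vh : ℤ} (hvh : Valued.v (hp * n₀) = exp (-vh)) (j : ℕ) {k₀ : ℤ} (hk₀ : vh + 2 * k₀ + j = 0)
    (H : Subgroup Kˣ) (hH : ∀ u : Kˣ, u ∈ H ↔ Valued.v (u : K) = 1 ∧ Valued.v ((u : K) - ρ u) ≤ Valued.v (ϖE ^ j * (α - ρ α)))
    (hnone : ∀ ω : K, Valued.v ω = 1 → ¬ Valued.v (n₀ * (ω * Θ ω) - ρ (n₀ * (ω * Θ ω))) ≤ exp (-(j : ℤ))) :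
    (levelSet ρ Θ α ϖE (hp * n₀) j 0).ncard = 0 := by
  have hh : hp * n₀ ≠ 0 := mul_ne_zero hhp (fun h0 => by rw [h0, map_zero] at hn₀; exact zero_ne_one hn₀)
  rw [F0P3cDyRamToricLevelCensusUnr.levelSet_eq_setOf hϖ]
  exact ncard_levelSet_zero_eq_zero_of_eq_empty hρρ hvρ hΘρ hvΘ hα hϖ hρϖ hh hvh j hk₀ H hH
    (setOf_twistDepth_le_eq_empty_of_antiFixed_mul hvΘ hρh hhp hn₀ _ hnone)

/-! ## §5 (ED. 2) The anisotropic index forms (`[U_M : 𝒪_jˣ] = (q+1)q^{j−1}`, `j ≥ 1`; `[U_M : B_c] = idxRK q d c` by ★ p857459) -/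

/-- **RamK INDEX FORM, anisotropic side, `a ≥ 1`, `j ≥ 1`, both depth sets inhabited**: `#L · [U:B] · [U:B′] = (q+1)q^{j−1} · ([U:B′] − [U:B])` — the sheet's
`n₋(j,a) = |G_j|·(1∕I(c) − 1∕I(c+1))` for `c = j − a ≤ 2d − 3`. [cite: Flicker1998UnitaryFL, Prop. 7 p. 84] [cite: Serre1979, Ch. V §3] -/
theorem ncard_levelSet_mul_eq_of_ramK_aniso [IsDiscreteValuationRing 𝒪[K]] [Finite 𝓀[K]]
    (hρρ : ∀ x, ρ (ρ x) = x) (hvρ : ∀ x, Valued.v (ρ x) = Valued.v x) (hΘρ : ∀ x, Θ (ρ x) = ρ (Θ x))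
    (hvΘ : ∀ x, Valued.v (Θ x) = Valued.v x) (hα : Valued.v (α - ρ α) = 1) (hϖ : Valued.v ϖE = exp (-1 : ℤ)) (hρϖ : ρ ϖE = ϖE)
    {hp n₀ : K} (hhp : hp ≠ 0) (hρh : ρ hp = -hp) (hn₀ : Valued.v n₀ = 1) {vh : ℤ} (hvh : Valued.v (hp * n₀) = exp (-vh))
    (hα1 : Valued.v α ≤ 1) {q : ℕ} (hq : Nat.card 𝓀[K] = q ^ 2) {j : ℕ} (hj : 1 ≤ j) {a : ℕ} (ha : 1 ≤ a) {k₀ : ℤ} (hk₀ : vh + 2 * k₀ + j = a)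
    (U H B B' : Subgroup Kˣ) (hU : ∀ u : Kˣ, u ∈ U ↔ Valued.v (u : K) = 1)
    (hH : ∀ u : Kˣ, u ∈ H ↔ Valued.v (u : K) = 1 ∧ Valued.v ((u : K) - ρ u) ≤ Valued.v (ϖE ^ j * (α - ρ α)))
    (hB : ∀ ω : Kˣ, ω ∈ B ↔ Valued.v (ω : K) = 1 ∧ Valued.v ((ω : K) * Θ ω - ρ ((ω : K) * Θ ω)) ≤ exp (-((j : ℤ) - a)))
    (hB' : ∀ ω : Kˣ, ω ∈ B' ↔ Valued.v (ω : K) = 1 ∧ Valued.v ((ω : K) * Θ ω - ρ ((ω : K) * Θ ω)) ≤ exp (-((j : ℤ) - a + 1)))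
    (hHB' : H ≤ B') (hBU : B ≤ U) {ω₂ : Kˣ} (hω₂ : Valued.v (ω₂ : K) = 1) (h₂ : Valued.v (n₀ * ((ω₂ : K) * Θ ω₂) - ρ (n₀ * ((ω₂ : K) * Θ ω₂))) ≤ exp (-((j : ℤ) - a + 1)))
    (hfin : ((QuotientGroup.mk : Kˣ → Kˣ ⧸ H) '' (ω₂ • (B : Set Kˣ))).Finite) :
    (levelSet ρ Θ α ϖE (hp * n₀) j a).ncard * B.relIndex U * B'.relIndex U = (q + 1) * q ^ (j - 1) * (B'.relIndex U - B.relIndex U) := by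
  have hB'B : B' ≤ B := fun ω hω => (hB ω).2 ⟨((hB' ω).1 hω).1, ((hB' ω).1 hω).2.trans (by rw [exp_le_exp]; omega)⟩
  have hcount := ncard_levelSet_eq_relIndex_sub_of_ramK_aniso hρρ hvρ hΘρ hvΘ hα hϖ hρϖ hhp hρh hn₀ hvh j ha hk₀ H B B' hH hB hB' hHB' hω₂ h₂ hfin
  have hHU : H.relIndex U = (q + 1) * q ^ (j - 1) :=
    relIndex_orderUnits_eq_of_unramified hρρ hvρ hα1 hα hϖ hq hj U H hU (fun u => by rw [hH, map_mul, map_pow, hα, mul_one])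
  have htB : H.relIndex B * B.relIndex U = (q + 1) * q ^ (j - 1) := by rw [Subgroup.relIndex_mul_relIndex H B U (hHB'.trans hB'B) hBU, hHU]
  have htB' : H.relIndex B' * B'.relIndex U = (q + 1) * q ^ (j - 1) := by rw [Subgroup.relIndex_mul_relIndex H B' U hHB' (hB'B.trans hBU), hHU]
  rw [hcount, Nat.sub_mul, Nat.sub_mul, Nat.mul_sub]
  congr 1
  · rw [htB]
  · rw [mul_right_comm, htB']

/-- **RamK INDEX FORM, anisotropic side, `a ≥ 1`, `j ≥ 1`, inner depth set empty**: `#L · [U:B] = (q+1)q^{j−1}` — the sheet's `n₋(j,a) = |G_j|∕I(c)` at `c = j − a = 2d − 2`.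
[cite: Flicker1998UnitaryFL, Prop. 7 p. 84] -/
theorem ncard_levelSet_mul_eq_of_ramK_aniso_of_empty [IsDiscreteValuationRing 𝒪[K]] [Finite 𝓀[K]]
    (hρρ : ∀ x, ρ (ρ x) = x) (hvρ : ∀ x, Valued.v (ρ x) = Valued.v x) (hΘρ : ∀ x, Θ (ρ x) = ρ (Θ x))
    (hvΘ : ∀ x, Valued.v (Θ x) = Valued.v x) (hα : Valued.v (α - ρ α) = 1) (hϖ : Valued.v ϖE = exp (-1 : ℤ)) (hρϖ : ρ ϖE = ϖE)
    {hp n₀ : K} (hhp : hp ≠ 0) (hρh : ρ hp = -hp) (hn₀ : Valued.v n₀ = 1) {vh : ℤ} (hvh : Valued.v (hp * n₀) = exp (-vh))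
    (hα1 : Valued.v α ≤ 1) {q : ℕ} (hq : Nat.card 𝓀[K] = q ^ 2) {j : ℕ} (hj : 1 ≤ j) {a : ℕ} (ha : 1 ≤ a) {k₀ : ℤ} (hk₀ : vh + 2 * k₀ + j = a)
    (U H B : Subgroup Kˣ) (hU : ∀ u : Kˣ, u ∈ U ↔ Valued.v (u : K) = 1)
    (hH : ∀ u : Kˣ, u ∈ H ↔ Valued.v (u : K) = 1 ∧ Valued.v ((u : K) - ρ u) ≤ Valued.v (ϖE ^ j * (α - ρ α)))
    (hB : ∀ ω : Kˣ, ω ∈ B ↔ Valued.v (ω : K) = 1 ∧ Valued.v ((ω : K) * Θ ω - ρ ((ω : K) * Θ ω)) ≤ exp (-((j : ℤ) - a)))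
    (hHB : H ≤ B) (hBU : B ≤ U) {ω₁ : Kˣ} (hω₁ : Valued.v (ω₁ : K) = 1) (h₁ : Valued.v (n₀ * ((ω₁ : K) * Θ ω₁) - ρ (n₀ * ((ω₁ : K) * Θ ω₁))) ≤ exp (-((j : ℤ) - a)))
    (hnone : ∀ ω : K, Valued.v ω = 1 → ¬ Valued.v (n₀ * (ω * Θ ω) - ρ (n₀ * (ω * Θ ω))) ≤ exp (-((j : ℤ) - a + 1))) :
    (levelSet ρ Θ α ϖE (hp * n₀) j a).ncard * B.relIndex U = (q + 1) * q ^ (j - 1) := by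
  rw [ncard_levelSet_eq_relIndex_of_ramK_aniso hρρ hvρ hΘρ hvΘ hα hϖ hρϖ hhp hρh hn₀ hvh j ha hk₀ H B hH hB hω₁ h₁ hnone,
    Subgroup.relIndex_mul_relIndex H B U hHB hBU]
  exact relIndex_orderUnits_eq_of_unramified hρρ hvρ hα1 hα hϖ hq hj U H hU (fun u => by rw [hH, map_mul, map_pow, hα, mul_one])

/-- **RamK INDEX FORM, anisotropic side, `a = 0`, `j ≥ 1`, depth set inhabited**: `#L_{h₊n₀}(j,0) · [U:B_j] = (q+1)q^{j−1}`. [cite: Flicker1998UnitaryFL, Prop. 7 p. 84] -/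
theorem ncard_levelSet_zero_mul_eq_of_ramK_aniso [IsDiscreteValuationRing 𝒪[K]] [Finite 𝓀[K]]
    (hρρ : ∀ x, ρ (ρ x) = x) (hvρ : ∀ x, Valued.v (ρ x) = Valued.v x) (hΘρ : ∀ x, Θ (ρ x) = ρ (Θ x))
    (hvΘ : ∀ x, Valued.v (Θ x) = Valued.v x) (hα : Valued.v (α - ρ α) = 1) (hϖ : Valued.v ϖE = exp (-1 : ℤ)) (hρϖ : ρ ϖE = ϖE)
    {hp n₀ : K} (hhp : hp ≠ 0) (hρh : ρ hp = -hp) (hn₀ : Valued.v n₀ = 1) {vh : ℤ} (hvh : Valued.v (hp * n₀) = exp (-vh))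
    (hα1 : Valued.v α ≤ 1) {q : ℕ} (hq : Nat.card 𝓀[K] = q ^ 2) {j : ℕ} (hj : 1 ≤ j) {k₀ : ℤ} (hk₀ : vh + 2 * k₀ + j = 0)
    (U H B : Subgroup Kˣ) (hU : ∀ u : Kˣ, u ∈ U ↔ Valued.v (u : K) = 1)
    (hH : ∀ u : Kˣ, u ∈ H ↔ Valued.v (u : K) = 1 ∧ Valued.v ((u : K) - ρ u) ≤ Valued.v (ϖE ^ j * (α - ρ α)))
    (hB : ∀ ω : Kˣ, ω ∈ B ↔ Valued.v (ω : K) = 1 ∧ Valued.v ((ω : K) * Θ ω - ρ ((ω : K) * Θ ω)) ≤ exp (-(j : ℤ)))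
    (hHB : H ≤ B) (hBU : B ≤ U) {ω₁ : Kˣ} (hω₁ : Valued.v (ω₁ : K) = 1) (h₁ : Valued.v (n₀ * ((ω₁ : K) * Θ ω₁) - ρ (n₀ * ((ω₁ : K) * Θ ω₁))) ≤ exp (-(j : ℤ))) :
    (levelSet ρ Θ α ϖE (hp * n₀) j 0).ncard * B.relIndex U = (q + 1) * q ^ (j - 1) := by
  rw [ncard_levelSet_zero_eq_relIndex_of_ramK_aniso hρρ hvρ hΘρ hvΘ hα hϖ hρϖ hhp hρh hn₀ hvh j hk₀ H B hH hB hω₁ h₁, Subgroup.relIndex_mul_relIndex H B U hHB hBU]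
  exact relIndex_orderUnits_eq_of_unramified hρρ hvρ hα1 hα hϖ hq hj U H hU (fun u => by rw [hH, map_mul, map_pow, hα, mul_one])

end Summit.HodgeConjecture.HodgeConjecture.Cruxes.H413.F0P3cDyRamToricLevelCensusRamK

end
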